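import Summits.Langlands.Langlands.Theorems.DyadicOddResidueOddPrimesRegularFM
import Literature.NumberTheory.Automorphic.FontaineMazurGL2OddPrimeTateTwist
import HarnessLib

/-!
# `DyadicOddResidue.OddPrimesRegularFM` (item stmt-Langlands-18743) from the printed theorem

The support item `OddPrimesRegularFM` of route `Langlands/DyadicOddResidue` — Fontaine–Mazur for
`GL₂/ℚ` at every odd prime in the regular case, in the summit's `L`-algebraic automorphic
rendering — from the named fact `XZhang2024_fontaineMazurGL2_tateTwist` (Pan 2022, Thm. 1.0.4 with
Thms. 7.1.1/8.0.24; X. Zhang 2024, Thm. 1.0.2 = Thms. 5.1.1/6.1.1: "`ρ` arises from a regular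
algebraic cuspidal automorphic representation of `GL₂(𝔸_ℚ)`", rendered as "a Tate twist `ρ ⊗ ε^m`
is the Galois representation of a newform") through the proved conversion
`oddPrimesRegularFM_of_tateTwistModularity` (newform `f^τ` ↦ `L`-algebraic cuspidal `π₂` with
Satake parameters the inverted Hecke roots, norm twist `π₂ ⊗ |det|^{-m}`, `ε(Frob_q) = q`).
CONDITIONAL result: trust base = {`XZhang2024_fontaineMazurGL2_tateTwist`} (irreducibly XL:
`p`-adic local Langlands for `GL₂(ℚ_p)`, patching of completed homology, Skinner–Wiles); the item
closes when that fact is discharged.  No statement of the route file is altered; the route decl is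
concluded BY NAME.
-/

noncomputable section

namespace Summit.Langlands.Langlands.Theorems

set_option linter.dupNamespace false -- project-wide option; `Summit.Langlands.Langlands` is the mandated namespace

open Literature.NumberTheory.Automorphic

/-- **`OddPrimesRegularFM` from Pan 2022 / X. Zhang 2024** (Tate-twist rendering
`XZhang2024_fontaineMazurGL2_tateTwist`), by `oddPrimesRegularFM_of_tateTwistModularity`.
Conditional on the named fact (D-0014).
[cite: XZhang2024FontaineMazurP3, Thm. 1.0.2] [cite: Pan2022, Thm. 1.0.4] -/
theorem oddPrimesRegularFM_of_XZhang2024_tateTwist (h : XZhang2024_fontaineMazurGL2_tateTwist) :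
    Summit.Langlands.Langlands.Theses.DyadicOddResidue.OddPrimesRegularFM :=
  oddPrimesRegularFM_of_tateTwistModularity h

end Summit.Langlands.Langlands.Theorems

end
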